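import Summits.FinalStateConjecture.FinalStateConjecture.Theorems.StarvedNecksNeckGapDecayOfCore
import HarnessLib

/-!
# `NeckGapDecay` from the hypothesis-free ANALYTIC form of its physics core (crux `StarvedNecks.NeckGapDecay`,
# stmt-FinalStateConjecture-16768, line `Sketch`; `--supports`)

Continuation lead c4.  The conjecture-level statement behind the crux, in its WEAKEST and most readable form
available in the tree: **`GapAnalyticAll`** — for every admissible datum, maximal vacuum development `𝒟`, honest `C⁴`
final-state decomposition `d` of `O = exteriorOf 𝒟 d.charted` (`HonestCore`, `HonestFar`, distinct hole velocities)
and EVERY hole `i`, there are a threshold `T₀`, a normalised dominating wall `W` (continuous, non-decreasing,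
sublinear, slope `≤ 1/(10‖Λᵢ‖²)`, `≥ R₀ + 2`, `≥ 3ρᵢ + 2` from `T₀`) and a gap ANALYTIC certificate
`GapAnalyticCert 𝒟 O d R₀ i T₀ W` (landed predicate, `…CertOfCoreStub`): ONE smooth open embedding `Ψg` of the late
sub-wall tube `{τ₁ < tᵢ, rᵢ < W(x⁰) + 1}` into `d.charted`, equal to the input chart `Ψᵢ` inside `R₁ + 1`, whose
`C²` deviation from boosted Kerrᵢ tends to `0` on the sub-wall slabs `{tᵢ = τ, rᵢ ≤ W(x⁰)}`.  This is literally the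
informal text of the crux ("the gap annulus is `C²`-certified by a chart `Ψg` of the late tube, `= Ψᵢ` inside
`R₁ + 1`, with `C²` deviation from boosted Kerrᵢ `→ 0` on the hole slabs out to `W`") without its soft consequences
(G4) orientation and (G5) sub-wall closure, which are theorems of the tree (S2/S3a/S4a/S4b).

* `neckGapDecay_of_gapAnalyticAll : GapAnalyticAll → <body of Theses.StarvedNecks.NeckGapDecay, verbatim>` — the
  tail of c3's `OfCore.neckGapDecay_of_gapCoreHolds` (p166469), verbatim after its first step;
* `gapAnalyticAll_of_gapCoreHolds : GapCoreHolds → GapAnalyticAll` — by `OfCoreGlue.cert_of_selfCertified`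
  (self-certified holes) and the landed P-glue `CertOfCoreStub.stub_certOfCoreFrom` with the bricks W1–W3 (the others).

So `GapAnalyticAll` is implied by the registered open stub `OfCore.GapCoreHolds` and still implies the crux: it is
the statement to file as the route's conjecture-level item (planner dossier `Cruxes/NeckGapDecay/PROMOTE-GapCore.md`).
Mathematically it is rate-free `C²` late-time decay of the vacuum metric on the intermediate zone
`{R₁ + 1 < rᵢ ≤ W(x⁰)}`, `W ≥ 3ρᵢ + 2`, in a gauge extending the input chart — unprinted even for `N = 1`
(nearest: Klainerman–Szeftel 2021–23, DHRT arXiv:2104.08222, Shen arXiv:2303.12758, Luk–Oh arXiv:2404.02220; see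
`…OfCore`).  Definitions introduced: `GapAnalyticAll` (Summit-level, stated through the landed predicate
`GapAnalyticCert`).  References: DHRT arXiv:2104.08222 §1; O'Neill 1983 Ch. 14.
-/

noncomputable section

open scoped Manifold ContDiff Topology ENNReal
open Filter Set Topology Literature.Geometry.Lorentzian Literature.Uncategorized

namespace Summit.FinalStateConjecture.FinalStateConjecture.Theorems.NeckGapDecay.ConnectionLevelCones.OfCore

open Summit.FinalStateConjecture.FinalStateConjecture.Theorems.NeckGapDecay.ConnectionLevelCones.CertOfCoreStub
  (GapAnalyticCert GapCoreCert CertOfCore CertOfCoreFrom stub_certOfCoreFrom)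
open Summit.FinalStateConjecture.FinalStateConjecture.Theorems.NeckGapDecay.ConnectionLevelCones.OfCoreGlue
open Summit.FinalStateConjecture.FinalStateConjecture.Theorems.NeckGapDecay.ConnectionLevelCones

-- the problem namespace `Summit.FinalStateConjecture.FinalStateConjecture` repeats the summit name by design
set_option linter.dupNamespace false
-- instance search through nested operator types `E4 →L[ℝ] E4 →L[ℝ] ℝ`
set_option maxSynthPendingDepth 3

/-- **`GapAnalyticAll` — the hypothesis-free analytic form of the physics of `NeckGapDecay`** (conjecture-level;
OPEN).  For every admissible datum, maximal vacuum development, honest `C⁴` decomposition of the exterior of its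
charted late region and EVERY hole `i`: a threshold `T₀`, a normalised dominating wall `W`, and a gap analytic
certificate `GapAnalyticCert` — one smooth open embedding of the late sub-wall tube into `d.charted`, equal to the
input chart inside `R₁ + 1`, `C²`-converging to boosted Kerrᵢ on the sub-wall slabs out to `W ≥ 3ρᵢ + 2`.
Implied by `GapCoreHolds` (`gapAnalyticAll_of_gapCoreHolds`), implies the crux (`neckGapDecay_of_gapAnalyticAll`).
Status: OPEN — rate-free `C²` late-time decay of the vacuum metric on the intermediate zone; unprinted even for
`N = 1`.  DHRT arXiv:2104.08222, §1 (deviation norms on slabs). -/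
def GapAnalyticAll : Prop :=
  ∀ (X : Type) [TopologicalSpace X] [ChartedSpace E3 X] [IsManifold (𝓡 3) ∞ X] [ConnectedSpace X]
    (D : InitialDataSet (𝓡 3) X), D ∈ admissibleVacuumData X →
    ∀ 𝒟 : VacuumCauchyDevelopment D, 𝒟.IsMaximal →
    ∀ (O : Set 𝒟.carrier) (d : FinalStateDecomposition 𝒟.toSpacetime O 4) (R₀ : ℝ),
      O = exteriorOf 𝒟.toCauchyDevelopment d.charted →
      HonestCore 𝒟.toSpacetime O 4 d R₀ → HonestFar 𝒟.toSpacetime O 4 d R₀ → DistinctVelocities d →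
      ∀ i : Fin d.N,
      ∃ (T₀ : ℝ) (W : ℝ → ℝ), Continuous W ∧ Monotone W ∧ Tendsto (fun s ↦ W s / s) atTop (𝓝 0) ∧
        (∀ s s', s ≤ s' → W s' ≤ W s + 1 / (10 * ‖(((d.motion i).1 : E4 ≃L[ℝ] E4) : E4 →L[ℝ] E4)‖ ^ 2) * (s' - s)) ∧
        (∀ s, R₀ + 2 ≤ W s) ∧ (∀ s, T₀ ≤ s → 3 * d.excision i s + 2 ≤ W s) ∧
        GapAnalyticCert 𝒟.toSpacetime O d R₀ i T₀ W

/-- **`GapCoreHolds ⇒ GapAnalyticAll`.**  Per hole: either the input chart is self-certified below a normalised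
dominating wall (`OfCoreGlue.cert_of_selfCertified`: the input chart itself is the analytic certificate), or
`GapCoreHolds` gives a core certificate and the landed P-glue `stub_certOfCoreFrom` (bricks W1–W3) packages it into
an analytic one.  The first step of c3's `neckGapDecay_of_gapCoreHolds`, isolated.  DHRT arXiv:2104.08222, §1. -/
theorem gapAnalyticAll_of_gapCoreHolds (hcore : GapCoreHolds) : GapAnalyticAll := by
  have hW1 : NearIdInjOpen := NearIdInjOpenStub.stub_nearIdInjOpen
  have hW2 : BilinPullbackNearIdConst := BilinPullbackNearIdConstStub.stub_bilinPullbackNearIdConst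
  have hW3 : MovingShellCutoff := MovingShellCutoffStub.stub_movingShellCutoff
  intro X _ _ _ _ D hD 𝒟 h𝒟 O d R₀ hO hc hf hdv i
  have hMR : 100 * d.mass i ≤ R₀ := (hc.1 i).2.1
  by_cases hself : (∃ (T₀ : ℝ) (W : ℝ → ℝ), Continuous W ∧ Monotone W ∧ Tendsto (fun s ↦ W s / s) atTop (𝓝 0) ∧
    (∀ s s', s ≤ s' → W s' ≤ W s + 1 / (10 * ‖(((d.motion i).1 : E4 ≃L[ℝ] E4) : E4 →L[ℝ] E4)‖ ^ 2) * (s' - s)) ∧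
    (∀ s, R₀ + 2 ≤ W s) ∧ (∀ s, T₀ ≤ s → 3 * d.excision i s + 2 ≤ W s) ∧
    Tendsto (fun τ ↦ supCkENorm (Subtype.val '' {x : (d.background i).domain |
      (d.background i).time x.1 = τ ∧ (d.background i).radius x.1 ≤ W (x.1 0)}) 2
      (𝒟.toSpacetime.deviationExtend (d.background i) (d.chart i))) atTop (𝓝 0))
  · obtain ⟨T₀, W, hWc, hWm, hWs, hWl, hWR, hWall, hG3⟩ := hself
    exact ⟨T₀, W, hWc, hWm, hWs, hWl, hWR, hWall, cert_of_selfCertified d R₀ i hWc hG3⟩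
  · obtain ⟨T₀, W, hWc, hWm, hWs, hWl, hWR, hWall, hcoreCert⟩ :=
      hcore X D hD 𝒟 h𝒟 O d R₀ hO hc hf hdv i hself
    exact ⟨T₀, W, hWc, hWm, hWs, hWl, hWR, hWall,
      stub_certOfCoreFrom hW1 hW2 hW3 𝒟.toSpacetime O d R₀ i T₀ W hMR hWc hcoreCert⟩

/-- **`NeckGapDecay` from `GapAnalyticAll`.**  The crux `Theses.StarvedNecks.NeckGapDecay` (body VERBATIM below, so
that the gate's probe `example : NeckGapDecay := by exact …` closes by `δ`-unfolding) follows from a normalised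
dominating wall with a gap analytic certificate for every hole: (G3) ⇒ quantitative `C⁰` clause
(`eventually_c0_le`), S4b ⇒ no late escape ⇒ (G5) by S4a, S2's anchor at `R₁ + 1` ⇒ (G4) by `g4_of_anchor`, (G1)
restricted by `g1_mono`, wall clause from the threshold — verbatim the tail of c3's `neckGapDecay_of_gapCoreHolds`.
DHRT arXiv:2104.08222, §1; O'Neill 1983, Ch. 14. -/
theorem neckGapDecay_of_gapAnalyticAll (hall : GapAnalyticAll) :
    open Literature.Geometry.Lorentzian in open scoped ContDiff ENNReal in let Hc:=(fun (𝓢 : Spacetime.{0} 4) (O : Set 𝓢.carrier) (k : ℕ) (d : FinalStateDecomposition 𝓢 O k) (R₀ : ℝ)=>let B:=d.background; let t:=fun i↦(B i).time; let r:=fun i↦(B i).radius; let Ψ:=d.chart; (∀ i, Kerr.IsSubextremal (d.mass i) (d.spin i) ∧ 100 * d.mass i ≤ R₀ ∧ 0 < ((d.motion i).1 : E4 ≃L[ℝ] E4) (E4.basisVector 0) 0) ∧ (∀ i (ϱ τ₂ : ℝ), R₀ ≤ ϱ → d.τ₀ < τ₂ → Ψ i '' {x | d.τ₀ < t i x.1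 ∧ t i x.1 < τ₂ ∧ r i x.1 < ϱ} ⊆ 𝓢.metric.causalPast 𝓢.timeOrientation (Ψ i '' (B i).truncTimeSlab ϱ τ₂)) ∧ (∀ i (τ' : ℝ) (ϱ : ℝ → ℝ), Continuous ϱ → d.τ₀ < τ' → let A:=Ψ i '' {x | τ' ≤ t i x.1 ∧ r i x.1 ≤ ϱ (t i x.1)}; closure A ∩ O ⊆ A) ∧ (∀ y : d.flatDomain, d.τ₀ < y.1 0 → 𝓢.timeOrientation.IsFutureDirected (mfderiv 𝓘(ℝ, E4) (𝓡 4) d.flatChart y (E4.basisVector 0)))); let Hf:=(fun (𝓢 : Spacetime.{0} 4) (O : Set 𝓢.carrier) (k : ℕ) (d : FinalStateDecomposition 𝓢 O k) (R₀ : ℝ)=>let B:=d.background; let t:=fun i↦(B i).time; let r:=fun i↦(B i).radius; let Φ:=d.flatChart; (∀ τ₂ : ℝ, d.τ₀ < τ₂ → Φ '' {y | d.τ₀ < y.1 0 ∧ y.1 0 < τ₂} ⊆ 𝓢.metric.causalPast 𝓢.timeOrientation (Φ '' (Minkowski.backgroundOn d.flatDomain).timeSlab τ₂)) ∧ (∀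 τ' : ℝ, d.τ₀ < τ' → closure (Φ '' {y | τ' ≤ y.1 0 ∧ ∀ i, d.excision i (y.1 0) + 1 ≤ r i y.1}) ⊆ Φ '' {y | τ' ≤ y.1 0}) ∧ (∀ i, ∃ T : ℝ, supCkENorm (Subtype.val '' {x : (B i).domain | T ≤ t i x.1 ∧ R₀ ≤ r i x.1 ∧ ∀ j, j ≠ i → r i x.1 ≤ r j x.1}) 0 (𝓢.deviationExtend (B i) (d.chart i)) ≤ ENNReal.ofReal (1 / (10 * ‖(((d.motion i).1 : E4 ≃L[ℝ] E4) : E4 →L[ℝ] E4)‖ ^ 2)))); ∀ (X : Type) [TopologicalSpace X] [ChartedSpace E3 X] [IsManifold (𝓡 3) ∞ X] [ConnectedSpace X] (D : InitialDataSet (𝓡 3) X), D ∈ admissibleVacuumData X → ∀ 𝒟 : VacuumCauchyDevelopment D, 𝒟.IsMaximal → ∀ (O : Set 𝒟.carrier) (d : FinalStateDecomposition 𝒟.toSpacetime O 4) (R₀ : ℝ), O = exteriorOf 𝒟.toCauchyDevelopment d.charted → Hc 𝒟.toSpacetime O 4 d R₀ → Hf 𝒟.toSpacetime O 4 d R₀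 → (∀ i j : Fin d.N, i ≠ j → ((d.motion i).1 : E4 ≃L[ℝ] E4) (E4.basisVector 0) ≠ ((d.motion j).1 : E4 ≃L[ℝ] E4) (E4.basisVector 0)) → ∀ i : Fin d.N, ∃ (R₁ τ₁ : ℝ) (W : ℝ → ℝ) (Ψg : (d.background i).domain → 𝒟.carrier), let B:=d.background i; let t:=B.time; let r:=B.radius; R₀ ≤ R₁ ∧ d.τ₀ ≤ τ₁ ∧ Continuous W ∧ (∀ s, τ₁ ≤ s → 3 * d.excision i s + 2 ≤ W s) ∧ (let U : Set B.domain := {x | τ₁ < t x.1 ∧ r x.1 < W (x.1 0) + 1}; ContMDiffOn 𝓘(ℝ, E4) (𝓡 4) ∞ Ψg U ∧ Topology.IsOpenEmbedding (U.restrict Ψg) ∧ Ψg '' U ⊆ d.charted) ∧ (∀ x : B.domain, r x.1 ≤ R₁ + 1 → Ψg x = d.chart i x) ∧ Tendsto (fun τ ↦ supCkENorm (Subtype.val '' {x : B.domain | t x.1 = τ ∧ r x.1 ≤ W (x.1 0)}) 2 (𝒟.toSpacetime.deviationExtend B Ψg)) atTop (𝓝 0) ∧ (∀ x : B.domain, τ₁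 ≤ t x.1 → R₁ ≤ r x.1 → r x.1 ≤ W (x.1 0) → 𝒟.toSpacetime.timeOrientation.IsFutureDirected (mfderiv 𝓘(ℝ, E4) (𝓡 4) Ψg x (((d.motion i).1 : E4 ≃L[ℝ] E4) (E4.basisVector 0)))) ∧ (∀ (τ' : ℝ) (ϱ : ℝ → ℝ), Continuous ϱ → τ₁ < τ' → (∀ x : B.domain, τ' ≤ t x.1 → r x.1 ≤ ϱ (t x.1) → r x.1 ≤ W (x.1 0)) → closure (Ψg '' {x | τ' ≤ t x.1 ∧ r x.1 ≤ ϱ (t x.1)}) ∩ O ⊆ Ψg '' {x | τ' ≤ t x.1 ∧ r x.1 ≤ ϱ (t x.1)}) := by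
  have hS4b := NoLateEscapeStub.stub_noLateEscape
  have hS2 := OrientationAnchorStub.stub_orientationAnchor
  have hS3a : Literature.Geometry.Lorentzian.BandAnchoredPaths := BandAnchoredPathsStub.stub_bandAnchoredPaths
  have hS4a : SubwallClosureOfNoEscape := SubwallClosureStub.stub_subwallClosureOfNoEscape
  intro Hc Hf X _ _ _ _ D hD 𝒟 h𝒟 O d R₀ hO hc hf hdv i
  have hf' : HonestFar 𝒟.toSpacetime O 4 d R₀ := hf
  have hanchor : OrientationAnchor 𝒟.toSpacetime O 4 d R₀ := hS2 X D hD 𝒟 h𝒟 O d R₀ hO hc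
  have hc' : HonestCore 𝒟.toSpacetime O 4 d R₀ := hc
  obtain ⟨hc1, hc2, hc3, hc4⟩ := hc'
  have hKpos : 0 < ‖(((d.motion i).1 : E4 ≃L[ℝ] E4) : E4 →L[ℝ] E4)‖ :=
    one_pos.trans_le (BoostedKerrLegs.one_le_norm_lorentz (d.motion i).1)
  have hcert := hall X D hD 𝒟 h𝒟 O d R₀ hO hc hf' hdv i
  obtain ⟨T₀, W, hWc, hWm, hWs, hWl, hWR, hWall, R₁, τ₁, Ψg, hR₁, hτ₁, hG1, hG2, hG3⟩ := hcert
  -- the quantitative `C⁰` clause from (G3)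
  have hcpos : 0 < 1 / (20 * ‖(((d.motion i).1 : E4 ≃L[ℝ] E4) : E4 →L[ℝ] E4)‖ ^ 2) := by positivity
  obtain ⟨τq, hτq⟩ := eventually_c0_le d i W Ψg hG3 hcpos
  -- restrict (G1) to `τ₁' := max τ₁ τq` and get a time without late escape (S4b)
  have h11' : τ₁ ≤ max τ₁ τq := le_max_left _ _
  have hq1' : τq ≤ max τ₁ τq := le_max_right _ _
  have hτ₀1 : d.τ₀ ≤ τ₁ := (le_max_left _ _).trans hτ₁
  have hT₀1 : T₀ ≤ τ₁ := (le_max_right _ _).trans hτ₁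
  have hG1' := g1_mono d i h11' hWc Ψg hG1
  obtain ⟨τ₂, h1'2, hnoesc⟩ :=
    hS4b X D 𝒟 O d R₀ hO hc hanchor i R₁ (max τ₁ τq) W Ψg hR₁ (hτ₀1.trans h11') hWc hWm hWs hWl
      hG1' hG2 (fun τ hτ ↦ hτq τ (hq1'.trans hτ))
  -- the anchor of the input chart at radius `R₁ + 1`
  obtain ⟨T, hT⟩ := hanchor i (R₁ + 1)
  have h2s : τ₂ ≤ max τ₂ T + 1 := by linarith [le_max_left τ₂ T]
  have hTs : T ≤ max τ₂ T + 1 := by linarith [le_max_right τ₂ T]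
  have h1s : τ₁ < max τ₂ T + 1 := by linarith [le_max_left τ₂ T]
  have hqs : τq ≤ max τ₂ T + 1 := hq1'.trans (h1'2.trans h2s)
  refine ⟨R₁, max τ₂ T + 1, W, Ψg, hR₁, hτ₀1.trans h1s.le, hWc, ?_, g1_mono d i h1s.le hWc Ψg hG1, hG2, hG3, ?_, ?_⟩
  · -- the wall clause
    intro s hs
    exact hWall s (hT₀1.trans (h1s.le.trans hs))
  · -- (G4)
    exact g4_of_anchor hS3a d i (hc1 i).2.1 (hc1 i).2.2 hR₁ hWc hWm Ψg hG1.1 hG2 hτq hT h1s hqs hTs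
  · -- (G5)
    intro τ' ϱ hϱ hτ' hsub
    exact hS4a X D 𝒟 O d R₀ hc i R₁ (max τ₁ τq) W Ψg hR₁ (hτ₀1.trans h11') hWc hG1' hG2 τ₂ h1'2
      hnoesc τ' ϱ hϱ (lt_of_le_of_lt h2s hτ') hsub

end Summit.FinalStateConjecture.FinalStateConjecture.Theorems.NeckGapDecay.ConnectionLevelCones.OfCore

end
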